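import Mathlib
import Literature.Computability.Complexity.CliqueTestGraphs
import Summits.PneNP.PneNP.Theorems.ConvexRankGatesConvexGateBlindCliqueDistance
import Summits.PneNP.PneNP.Theorems.ConvexRankGatesConvexGateBlindSymmetricHard

/-!
# PneNP / ConvexRankGates — `ConvexGateBlind`: no SYMMETRIC monotone LP gate computes `CLIQUE(m, m^δ)` (every `δ < 1/2`)

Helpers (`--supports stmt-PneNP-10680`). The crux's informal statement singles out the single-LP-gate case ("the open
problem of Oliveira–Pudlák 2019": one monotone LP-feasibility gate `x ↦ [∃ z ≥ 0, A z ≤ b + B x]`, `B ≥ 0`, of size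
`p + q ≤ m^c`, computing `CLIQUE(m, ⌈m^δ⌉₊)`). THIS FILE settles its SYMMETRIC sub-case unconditionally: if the gate is
`Sym(m)`-symmetric — vertex relabellings act on the constraints (`πp : Sym(m) → Sym(p)`) and on the auxiliary variables
(`πq : Sym(m) → Sym(q)`, both homomorphisms) with `A_{πp σ i, πq σ j} = A_{ij}`, `b_{πp σ i} = b_i`, `B_{πp σ i, σe} = B_{i,e}`
— then it does NOT compute `CLIQUE(m, ⌈m^δ⌉₊)`, for every `δ ∈ (0,1/2)` and every `c`, eventually in `m`
(`symmetric_lpGate_blind`, registered stub `symmetric_gate`). In fact symmetry under the permutations of the first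
`k² = ⌈m^δ⌉₊²` vertices (fixing the rest) already suffices (`symmetric_lpGate_blind_local`, stub `symmetric_gate_local`): a
monotone LP gate for CLIQUE must break the symmetry of EVERY `m^{2δ}`-subset of the vertices. All lemmas are proved for an
arbitrary subgroup `G ≤ Sym(m)` acting on the data.

Proof. `lpGate_cliqueDist_symmFactorisation`: the explicit factorisation of `D - εJ` extracted from an LP gate
(`lpGate_cliqueDist_factorisation` of `…CliqueDistance.lean`: Farkas certificates of the rejected inputs, witnesses of the
clique vectors, `p + q + 2#E + 1` terms) has `Sym(m)`-SYMMETRIC row objects as soon as the clique witnesses are chosen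
equivariantly — which averaging over `Sym(m)` achieves (`exists_equivariant_witness`: each relabelled witness is feasible
by the symmetry of the data, the average is feasible by convexity, and it is equivariant because `πq` is a homomorphism).
Then `symmetric_cliqueDistConeRankHard` (`…SymmetricHard.lean`). [new]
-/

set_option linter.dupNamespace false

namespace Summit.PneNP.PneNP.Theorems

open Matrix Finset Filter Literature.Computability.Complexity
open Summit.PneNP.PneNP.Cruxes.ConvexGateBlind.StrictRankConicCover (Edge cdist)

noncomputable section

/-! ## Equivariant clique witnesses by averaging -/

/-- **Equivariant witnesses.** If the LP data are symmetric (`A_{πp σ i, πq σ j} = A_{ij}`, right-hand sides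
`r_{σQ}(πp σ i) = r_Q(i)`, `πq` a homomorphism) and every `k`-clique vector has a feasible witness `z ≥ 0`, `A z ≤ r_Q`, then
the witnesses can be chosen EQUIVARIANTLY: `z_{σQ}(πq σ j) = z_Q(j)`. (Average the relabelled witnesses over `Sym(m)`.)
[folklore] -/
theorem exists_equivariant_witness {m k p q : ℕ} (G : Subgroup (Equiv.Perm (Fin m))) (A : Fin p → Fin q → ℝ)
    (r : Finset (Fin m) → Fin p → ℝ) (πp : G →* Equiv.Perm (Fin p)) (πq : G →* Equiv.Perm (Fin q))
    (hA : ∀ (σ : G) i j, A (πp σ i) (πq σ j) = A i j)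
    (hr : ∀ (σ : G) (Q : Finset (Fin m)) i, r (Q.map (σ : Equiv.Perm (Fin m)).toEmbedding) (πp σ i) = r Q i)
    (hwit : ∀ Q : Finset (Fin m), Q.card = k → ∃ z : Fin q → ℝ, (∀ j, 0 ≤ z j) ∧ ∀ i, ∑ j, A i j * z j ≤ r Q i) :
    ∃ z : Finset (Fin m) → Fin q → ℝ,
      (∀ Q, Q.card = k → (∀ j, 0 ≤ z Q j) ∧ ∀ i, ∑ j, A i j * z Q j ≤ r Q i) ∧
      ∀ (σ : G) Q j, z (Q.map (σ : Equiv.Perm (Fin m)).toEmbedding) (πq σ j) = z Q j := by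
  classical
  have hwit' : ∀ Q : Finset (Fin m), ∃ z : Fin q → ℝ, Q.card = k → (∀ j, 0 ≤ z j) ∧ ∀ i, ∑ j, A i j * z j ≤ r Q i := by
    intro Q
    by_cases hQ : Q.card = k
    · obtain ⟨z, hz⟩ := hwit Q hQ
      exact ⟨z, fun _ => hz⟩
    · exact ⟨0, fun h => absurd h hQ⟩
  choose z₀ hz₀ using hwit'
  set N : ℝ := (Fintype.card G : ℝ) with hN
  have hNpos : 0 < N := by rw [hN]; exact_mod_cast Fintype.card_pos
  refine ⟨fun Q j => (∑ σ : G, z₀ (Q.map (σ : Equiv.Perm (Fin m)).toEmbedding) (πq σ j)) / N, ?_, ?_⟩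
  · intro Q hQ
    have hQσ : ∀ σ : G, (Q.map (σ : Equiv.Perm (Fin m)).toEmbedding).card = k := fun σ => by rw [card_map, hQ]
    constructor
    · intro j
      exact div_nonneg (Finset.sum_nonneg fun σ _ => (hz₀ _ (hQσ σ)).1 _) hNpos.le
    · intro i
      have key : ∀ σ : G, ∑ j, A i j * z₀ (Q.map (σ : Equiv.Perm (Fin m)).toEmbedding) (πq σ j) ≤ r Q i := by
        intro σ
        have h1 := (hz₀ _ (hQσ σ)).2 (πp σ i)
        rw [hr] at h1
        calc ∑ j, A i j * z₀ (Q.map (σ : Equiv.Perm (Fin m)).toEmbedding) (πq σ j)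
            = ∑ j, A (πp σ i) (πq σ j) * z₀ (Q.map (σ : Equiv.Perm (Fin m)).toEmbedding) (πq σ j) := by simp_rw [hA]
          _ = ∑ j, A (πp σ i) j * z₀ (Q.map (σ : Equiv.Perm (Fin m)).toEmbedding) j :=
              Equiv.sum_comp (πq σ) (fun j => A (πp σ i) j * z₀ (Q.map (σ : Equiv.Perm (Fin m)).toEmbedding) j)
          _ ≤ r Q i := h1
      calc ∑ j, A i j * ((∑ σ : G, z₀ (Q.map (σ : Equiv.Perm (Fin m)).toEmbedding) (πq σ j)) / N)
          = (∑ σ : G, ∑ j, A i j * z₀ (Q.map (σ : Equiv.Perm (Fin m)).toEmbedding) (πq σ j)) / N := by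
            rw [Finset.sum_comm, Finset.sum_div]
            refine Finset.sum_congr rfl fun j _ => ?_
            rw [← Finset.mul_sum]
            ring
        _ ≤ (∑ _σ : G, r Q i) / N :=
            div_le_div_of_nonneg_right (Finset.sum_le_sum fun σ _ => key σ) hNpos.le
        _ = r Q i := by
            rw [Finset.sum_const, Finset.card_univ, nsmul_eq_mul, ← hN]
            field_simp
  · intro σ Q j
    show (∑ π : G, z₀ ((Q.map (σ : Equiv.Perm (Fin m)).toEmbedding).map (π : Equiv.Perm (Fin m)).toEmbedding)
        (πq π (πq σ j))) / N = (∑ π : G, z₀ (Q.map (π : Equiv.Perm (Fin m)).toEmbedding) (πq π j)) / N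
    congr 1
    have hre : ∀ π : G, z₀ ((Q.map (σ : Equiv.Perm (Fin m)).toEmbedding).map (π : Equiv.Perm (Fin m)).toEmbedding)
        (πq π (πq σ j)) = z₀ (Q.map ((π * σ : G) : Equiv.Perm (Fin m)).toEmbedding) (πq (π * σ) j) := by
      intro π
      rw [map_mul, Equiv.Perm.mul_apply, Subgroup.coe_mul, Equiv.Perm.mul_def, Equiv.trans_toEmbedding, Finset.map_map]
    simp_rw [hre]
    exact Fintype.sum_equiv (Equiv.mulRight σ) _ _ (fun π => rfl)

/-! ## A symmetric LP gate factorises `D - εJ` with symmetric row objects -/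

/-- **A symmetric LP gate computing CLIQUE factorises `D - εJ` with SYMMETRIC row objects.** As
`lpGate_cliqueDist_factorisation` (same terms, indexed by `(Fin p ⊕ Fin q) ⊕ ((E ⊕ E) ⊕ Unit)`), plus: if vertex
relabellings act on constraints and variables (`πp`, `πq` homomorphisms) and on edges (`emap σ`, bijective, with
`cliqueVec (σQ) (emap σ e) = cliqueVec Q e`) so that `A, b, B` are invariant, then the row objects `V` are symmetric:
`V (τ σ l) (σ Q) = V l Q` for the relabelling `τ σ = (πp σ ⊕ πq σ) ⊕ ((emap σ ⊕ emap σ) ⊕ id)`. [new] -/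
theorem lpGate_cliqueDist_symmFactorisation {m k p q : ℕ} (A : Fin p → Fin q → ℝ) (b : Fin p → ℝ)
    (B : Fin p → Edge m → ℝ) (hB : ∀ i e, 0 ≤ B i e)
    (hcomp : ∀ x : Edge m → Bool, cliqueFn m k x = true ↔
      ∃ z : Fin q → ℝ, (∀ j, 0 ≤ z j) ∧ ∀ i, ∑ j, A i j * z j ≤ b i + ∑ e, B i e * (if x e then (1 : ℝ) else 0))
    (G : Subgroup (Equiv.Perm (Fin m))) (πp : G →* Equiv.Perm (Fin p)) (πq : G →* Equiv.Perm (Fin q))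
    (emap : G → Edge m → Edge m) (hemap : ∀ σ, Function.Bijective (emap σ))
    (hemapQ : ∀ (σ : G) (Q : Finset (Fin m)) e, cliqueVec (Q.map (σ : Equiv.Perm (Fin m)).toEmbedding) (emap σ e) = cliqueVec Q e)
    (hA : ∀ (σ : G) i j, A (πp σ i) (πq σ j) = A i j) (hb : ∀ (σ : G) i, b (πp σ i) = b i)
    (hBs : ∀ (σ : G) i e, B (πp σ i) (emap σ e) = B i e) :
    ∃ ε : ℝ, 0 < ε ∧ ∃ (U : (Edge m → Bool) → ((Fin p ⊕ Fin q) ⊕ ((Edge m ⊕ Edge m) ⊕ Unit)) → ℝ)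
      (V : ((Fin p ⊕ Fin q) ⊕ ((Edge m ⊕ Edge m) ⊕ Unit)) → Finset (Fin m) → ℝ),
      (∀ u l, 0 ≤ U u l) ∧ (∀ l Q, 0 ≤ V l Q) ∧
      (∀ (Q : Finset (Fin m)) (u : Edge m → Bool), Q.card = k → cliqueFn m k u = false →
        (∑ e, if cliqueVec Q e = true ∧ u e = false then (1 : ℝ) else 0) - ε = ∑ l, U u l * V l Q) ∧
      ∀ (σ : G) l Q,
        V (Sum.map (Sum.map (πp σ) (πq σ)) (Sum.map (Sum.map (emap σ) (emap σ)) id) l)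
          (Q.map (σ : Equiv.Perm (Fin m)).toEmbedding) = V l Q := by
  classical
  -- right-hand sides and their symmetry on clique vectors
  set r : (Edge m → Bool) → Fin p → ℝ := fun x i => b i + ∑ e, B i e * (if x e then (1 : ℝ) else 0) with hr
  have hrsym : ∀ (σ : G) (Q : Finset (Fin m)) i,
      r (cliqueVec (Q.map (σ : Equiv.Perm (Fin m)).toEmbedding)) (πp σ i) = r (cliqueVec Q) i := by
    intro σ Q i
    simp only [hr]
    rw [hb]
    congr 1
    symm
    refine Fintype.sum_bijective (emap σ) (hemap σ) _ _ (fun e => ?_)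
    rw [hBs, hemapQ]
  -- certificates of the rejected (= clique-free) inputs
  have hcert : ∀ u : Edge m → Bool, ∃ y : Fin p → ℝ, cliqueFn m k u = false →
      (∀ i, 0 ≤ y i) ∧ (∀ j, 0 ≤ ∑ i, y i * A i j) ∧ ∑ i, y i * r u i < 0 := by
    intro u
    by_cases hu : cliqueFn m k u = false
    · have hinf : ¬ ∃ z : Fin q → ℝ, (∀ j, 0 ≤ z j) ∧ ∀ i, ∑ j, A i j * z j ≤ r u i := by
        intro hz'
        have h := (hcomp u).2 hz'
        rw [hu] at h
        exact Bool.noConfusion h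
      obtain ⟨y, ⟨hy1, hy2, -⟩, hneg⟩ := exists_mem_certPolytope_of_infeasible A (r u) hinf
      exact ⟨y, fun _ => ⟨hy1, hy2, hneg⟩⟩
    · exact ⟨0, fun h => absurd h hu⟩
  choose y hy using hcert
  -- EQUIVARIANT witnesses of the clique vectors
  have hwit : ∀ Q : Finset (Fin m), Q.card = k →
      ∃ z : Fin q → ℝ, (∀ j, 0 ≤ z j) ∧ ∀ i, ∑ j, A i j * z j ≤ r (cliqueVec Q) i := by
    intro Q hQ
    exact (hcomp _).1 (cliqueFn_cliqueVec hQ.ge)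
  obtain ⟨z, hz, hzsym⟩ := exists_equivariant_witness G A (fun Q => r (cliqueVec Q)) πp πq hA hrsym hwit
  -- derived data
  let w : (Edge m → Bool) → Edge m → ℝ := fun u e => ∑ i, y u i * B i e
  let θ : (Edge m → Bool) → ℝ := fun u => -∑ i, y u i * b i
  let W : (Edge m → Bool) → ℝ := fun u => 1 + ∑ e, w u e
  let εu : (Edge m → Bool) → ℝ := fun u => (θ u - ∑ e, w u e * (if u e then (1 : ℝ) else 0)) / W u
  have hw0 : ∀ u, cliqueFn m k u = false → ∀ e, 0 ≤ w u e :=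
    fun u hu e => Finset.sum_nonneg fun i _ => mul_nonneg ((hy u hu).1 i) (hB i e)
  have hW : ∀ u, cliqueFn m k u = false → 0 < W u := by
    intro u hu
    have : 0 ≤ ∑ e, w u e := Finset.sum_nonneg fun e _ => hw0 u hu e
    simp only [W]
    linarith
  have hwW : ∀ u, cliqueFn m k u = false → ∀ e, w u e ≤ W u := by
    intro u hu e
    have : w u e ≤ ∑ e, w u e := Finset.single_le_sum (fun e _ => hw0 u hu e) (Finset.mem_univ e)
    simp only [W]
    linarith
  -- the value of the certificate at an input
  have hval : ∀ u x, ∑ i, y u i * r x i = ∑ e, w u e * (if x e then (1 : ℝ) else 0) - θ u := by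
    intro u x
    simp only [hr, w, θ]
    rw [sum_mul_rows_eq]
    ring
  have hεu : ∀ u, cliqueFn m k u = false → 0 < εu u := by
    intro u hu
    have h := (hy u hu).2.2
    rw [hval] at h
    exact div_pos (by linarith) (hW u hu)
  -- the uniform margin
  have hε : ∃ ε : ℝ, 0 < ε ∧ ∀ u, cliqueFn m k u = false → ε ≤ εu u := by
    by_cases hex : ∃ u : Edge m → Bool, cliqueFn m k u = false
    · have hne : (univ.filter fun u : Edge m → Bool => cliqueFn m k u = false).Nonempty := by
        obtain ⟨u, hu⟩ := hex
        exact ⟨u, Finset.mem_filter.2 ⟨Finset.mem_univ _, hu⟩⟩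
      obtain ⟨u₀, hu₀, hmin⟩ := Finset.exists_min_image _ εu hne
      exact ⟨εu u₀, hεu u₀ (Finset.mem_filter.1 hu₀).2, fun u hu =>
        hmin u (Finset.mem_filter.2 ⟨Finset.mem_univ _, hu⟩)⟩
    · exact ⟨1, one_pos, fun u hu => absurd ⟨u, hu⟩ hex⟩
  obtain ⟨ε, hε0, hεle⟩ := hε
  refine ⟨ε, hε0, ?_⟩
  -- the factors (zero outside the relevant rows / columns)
  let Uf : (Edge m → Bool) → ((Fin p ⊕ Fin q) ⊕ ((Edge m ⊕ Edge m) ⊕ Unit)) → ℝ := fun u l =>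
    if cliqueFn m k u = false then Sum.elim
      (Sum.elim (fun i => y u i / W u) (fun j => (∑ i, y u i * A i j) / W u))
      (Sum.elim (Sum.elim (fun e => if u e then 0 else (W u - w u e) / W u)
        (fun e => if u e then w u e / W u else 0)) (fun _ => εu u - ε)) l else 0
  let Vf : ((Fin p ⊕ Fin q) ⊕ ((Edge m ⊕ Edge m) ⊕ Unit)) → Finset (Fin m) → ℝ := fun l Q =>
    if Q.card = k then Sum.elim
      (Sum.elim (fun i => r (cliqueVec Q) i - ∑ j, A i j * z Q j) (fun j => z Q j))
      (Sum.elim (Sum.elim (fun e => if cliqueVec Q e then (1 : ℝ) else 0)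
        (fun e => if cliqueVec Q e then (0 : ℝ) else 1)) (fun _ => 1)) l else 0
  refine ⟨Uf, Vf, fun u l => ?_, fun l Q => ?_, fun Q u hQ hu => ?_, fun σ l Q => ?_⟩
  · by_cases hu : cliqueFn m k u = false
    · simp only [Uf, if_pos hu]
      rcases l with (i | j) | ((e | e) | _)
      · exact div_nonneg ((hy u hu).1 i) (hW u hu).le
      · exact div_nonneg ((hy u hu).2.1 j) (hW u hu).le
      · simp only [Sum.elim_inl, Sum.elim_inr]
        split_ifs
        · exact le_rfl
        · exact div_nonneg (by linarith [hwW u hu e]) (hW u hu).le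
      · simp only [Sum.elim_inl, Sum.elim_inr]
        split_ifs
        · exact div_nonneg (hw0 u hu e) (hW u hu).le
        · exact le_rfl
      · simp only [Sum.elim_inr, sub_nonneg]
        exact hεle u hu
    · simp only [Uf, if_neg hu]
      exact le_rfl
  · by_cases hQ : Q.card = k
    · simp only [Vf, if_pos hQ]
      rcases l with (i | j) | ((e | e) | _)
      · simp only [Sum.elim_inl, sub_nonneg]
        exact (hz Q hQ).2 i
      · exact (hz Q hQ).1 j
      · simp only [Sum.elim_inl, Sum.elim_inr]
        split_ifs <;> norm_num
      · simp only [Sum.elim_inl, Sum.elim_inr]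
        split_ifs <;> norm_num
      · simp only [Sum.elim_inr]
        norm_num
    · simp only [Vf, if_neg hQ]
      exact le_rfl
  · -- the identity `D[Q,u] - ε = ∑ U V`
    have hWpos := hW u hu
    have hWne : W u ≠ 0 := hWpos.ne'
    simp only [Uf, Vf, if_pos hu, if_pos hQ, Fintype.sum_sum_type, Sum.elim_inl, Sum.elim_inr,
      Finset.univ_unique, Finset.sum_singleton]
    have S1 : ∑ i, y u i / W u * (r (cliqueVec Q) i - ∑ j, A i j * z Q j) +
        ∑ j, (∑ i, y u i * A i j) / W u * z Q j = (∑ i, y u i * r (cliqueVec Q) i) / W u := by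
      have hswap : ∑ j, (∑ i, y u i * A i j) / W u * z Q j = ∑ i, y u i / W u * ∑ j, A i j * z Q j := by
        simp only [Finset.sum_div, Finset.sum_mul, Finset.mul_sum]
        rw [Finset.sum_comm]
        exact Finset.sum_congr rfl fun i _ => Finset.sum_congr rfl fun j _ => by ring
      rw [hswap, ← Finset.sum_add_distrib, Finset.sum_div]
      exact Finset.sum_congr rfl fun i _ => by ring
    have S2 : ∀ e : Edge m, (if u e then 0 else (W u - w u e) / W u) * (if cliqueVec Q e then (1 : ℝ) else 0) +
        (if u e then w u e / W u else 0) * (if cliqueVec Q e then (0 : ℝ) else 1) =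
        (W u * (if cliqueVec Q e = true ∧ u e = false then (1 : ℝ) else 0)
          - w u e * (if cliqueVec Q e then (1 : ℝ) else 0) + w u e * (if u e then (1 : ℝ) else 0)) / W u := by
      intro e
      cases hue : u e <;> cases hQe : cliqueVec Q e <;> simp
    have S2sum : ∑ e : Edge m, ((if u e then 0 else (W u - w u e) / W u) * (if cliqueVec Q e then (1 : ℝ) else 0)) +
        ∑ e : Edge m, ((if u e then w u e / W u else 0) * (if cliqueVec Q e then (0 : ℝ) else 1)) =
        (W u * (∑ e, if cliqueVec Q e = true ∧ u e = false then (1 : ℝ) else 0)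
          - ∑ e, w u e * (if cliqueVec Q e then (1 : ℝ) else 0) + ∑ e, w u e * (if u e then (1 : ℝ) else 0)) / W u := by
      rw [← Finset.sum_add_distrib, Finset.sum_congr rfl fun e _ => S2 e, ← Finset.sum_div, Finset.sum_add_distrib,
        Finset.sum_sub_distrib, Finset.mul_sum]
    rw [S1, S2sum, mul_one, hval u (cliqueVec Q)]
    simp only [εu]
    field_simp
    ring
  · -- symmetry of the row objects
    have hcardσ : (Q.map (σ : Equiv.Perm (Fin m)).toEmbedding).card = Q.card := card_map _
    by_cases hQ : Q.card = k
    · have hQσ : (Q.map (σ : Equiv.Perm (Fin m)).toEmbedding).card = k := by rw [hcardσ, hQ]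
      simp only [Vf, if_pos hQ, if_pos hQσ]
      rcases l with (i | j) | ((e | e) | uu)
      · -- slack of a constraint
        simp only [Sum.map_inl, Sum.elim_inl]
        rw [hrsym σ Q i]
        congr 1
        calc ∑ j, A (πp σ i) j * z (Q.map (σ : Equiv.Perm (Fin m)).toEmbedding) j
            = ∑ j, A (πp σ i) (πq σ j) * z (Q.map (σ : Equiv.Perm (Fin m)).toEmbedding) (πq σ j) :=
              (Equiv.sum_comp (πq σ) (fun j => A (πp σ i) j * z (Q.map (σ : Equiv.Perm (Fin m)).toEmbedding) j)).symm
          _ = ∑ j, A i j * z Q j := Finset.sum_congr rfl fun j _ => by rw [hA, hzsym]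
      · -- auxiliary variable
        simp only [Sum.map_inl, Sum.map_inr, Sum.elim_inl, Sum.elim_inr]
        exact hzsym σ Q j
      · simp only [Sum.map_inl, Sum.map_inr, Sum.elim_inl, Sum.elim_inr]
        rw [hemapQ]
      · simp only [Sum.map_inl, Sum.map_inr, Sum.elim_inl, Sum.elim_inr]
        rw [hemapQ]
      · simp only [Sum.map_inr, Sum.elim_inr, id_eq]
    · have hQσ : ¬ (Q.map (σ : Equiv.Perm (Fin m)).toEmbedding).card = k := by rw [hcardσ]; exact hQ
      simp only [Vf, if_neg hQ, if_neg hQσ]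

/-! ## Vertex relabellings act on the edges of `K_m` -/

-- The edge permutation of `K_m` induced by a vertex permutation `σ` is written
-- `(SimpleGraph.Iso.completeGraph σ).mapEdgeSet : Edge m ≃ Edge m` throughout (no new definition).

/-- The clique vector is natural: `cliqueVec (σQ) (σe) = cliqueVec Q e`. [folklore] -/
theorem cliqueVec_map_edgePerm {m : ℕ} (σ : Equiv.Perm (Fin m)) (Q : Finset (Fin m)) (e : Edge m) :
    cliqueVec (Q.map σ.toEmbedding) ((SimpleGraph.Iso.completeGraph σ).mapEdgeSet e) = cliqueVec Q e := by
  unfold cliqueVec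
  rw [decide_eq_decide]
  have hcoe : (((SimpleGraph.Iso.completeGraph σ).mapEdgeSet e : Edge m) : Sym2 (Fin m)) = Sym2.map σ (e : Sym2 (Fin m)) := rfl
  rw [hcoe]
  constructor
  · intro h v hv
    have := h (σ v) (Sym2.mem_map.2 ⟨v, hv, rfl⟩)
    rw [Finset.mem_map_equiv, Equiv.symm_apply_apply] at this
    exact this
  · intro h w hw
    obtain ⟨v, hv, rfl⟩ := Sym2.mem_map.1 hw
    rw [Finset.mem_map_equiv, Equiv.symm_apply_apply]
    exact h v hv

/-! ## No symmetric LP gate computes CLIQUE — symmetric on `k²` vertices suffices -/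

/-- **No monotone LP gate that is symmetric on the first `k²` vertices computes `CLIQUE(m, ⌈m^δ⌉₊)` (every `δ ∈ (0,1/2)`,
every `c`).** Eventually in `m` (`k = ⌈m^δ⌉₊`): for all `p + q ≤ m^c`, all LP data `A, b, B ≥ 0`, and all homomorphisms
`πp`, `πq` from the group of vertex permutations FIXING EVERY VERTEX `≥ k²` to `Sym(p)`, `Sym(q)` that make the data invariant
(`A_{πp σ i, πq σ j} = A_{ij}`, `b_{πp σ i} = b_i`, `B_{πp σ i, σ e} = B_{i,e}`), the gate `x ↦ [∃ z ≥ 0, A z ≤ b + B x]` does not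
compute `CLIQUE(m, ⌈m^δ⌉₊)`: a monotone LP gate for CLIQUE must break the symmetry of every `m^{2δ}`-subset of the vertices. [new] -/
theorem symmetric_lpGate_blind_local {δ : ℝ} (hδ0 : 0 < δ) (hδ : δ < 1 / 2) (c : ℕ) :
    ∀ᶠ m : ℕ in atTop, ∀ (p q : ℕ), p + q ≤ m ^ c →
      ∀ (A : Fin p → Fin q → ℝ) (b : Fin p → ℝ) (B : Fin p → Edge m → ℝ), (∀ i e, 0 ≤ B i e) →
      ∀ (πp : fixingSubgroup (Equiv.Perm (Fin m)) {v : Fin m | ⌈(m : ℝ) ^ δ⌉₊ * ⌈(m : ℝ) ^ δ⌉₊ ≤ v.val} →* Equiv.Perm (Fin p))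
        (πq : fixingSubgroup (Equiv.Perm (Fin m)) {v : Fin m | ⌈(m : ℝ) ^ δ⌉₊ * ⌈(m : ℝ) ^ δ⌉₊ ≤ v.val} →* Equiv.Perm (Fin q)),
      (∀ σ i j, A (πp σ i) (πq σ j) = A i j) → (∀ σ i, b (πp σ i) = b i) →
      (∀ σ i e, B (πp σ i) ((SimpleGraph.Iso.completeGraph (σ : Equiv.Perm (Fin m))).mapEdgeSet e) = B i e) →
      ¬ ∀ x : Edge m → Bool, cliqueFn m ⌈(m : ℝ) ^ δ⌉₊ x = true ↔
          ∃ z : Fin q → ℝ, (∀ j, 0 ≤ z j) ∧ ∀ i, ∑ j, A i j * z j ≤ b i + ∑ e, B i e * (if x e then (1 : ℝ) else 0) := by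
  filter_upwards [symmetric_cliqueDistConeRankHard_local hδ0 hδ (c + 3), Filter.eventually_ge_atTop 3] with m hm hm3
  set G := fixingSubgroup (Equiv.Perm (Fin m)) {v : Fin m | ⌈(m : ℝ) ^ δ⌉₊ * ⌈(m : ℝ) ^ δ⌉₊ ≤ v.val} with hG
  intro p q hpq A b B hB πp πq hA hb hBs hcomp
  classical
  obtain ⟨ε, hε, U, V, hU, hV, hfact, hsym⟩ := lpGate_cliqueDist_symmFactorisation A b B hB hcomp G πp πq
    (fun σ => (SimpleGraph.Iso.completeGraph (σ : Equiv.Perm (Fin m))).mapEdgeSet)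
    (fun σ => (SimpleGraph.Iso.completeGraph (σ : Equiv.Perm (Fin m))).mapEdgeSet.bijective)
    (fun σ Q e => cliqueVec_map_edgePerm (σ : Equiv.Perm (Fin m)) Q e) hA hb hBs
  -- size of the index type: `p + q + 2#E + 1 ≤ m^c + 2m² + 1 ≤ m^{c+3}`
  have hE : Fintype.card (Edge m) ≤ m ^ 2 := card_edgeSet_top_le m
  have hcard : Fintype.card ((Fin p ⊕ Fin q) ⊕ ((Edge m ⊕ Edge m) ⊕ Unit)) ≤ m ^ (c + 3) := by
    simp only [Fintype.card_sum, Fintype.card_fin, Fintype.card_unit]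
    have hm1 : 1 ≤ m := by omega
    have hc1 : 1 ≤ m ^ c := Nat.one_le_pow c m hm1
    have hcube : 2 * m ^ 2 + 2 ≤ m ^ 3 := by nlinarith
    have h3 : m ^ (c + 3) = m ^ c * m ^ 3 := by ring
    have key : m ^ c + m ^ 3 ≤ m ^ c * m ^ 3 + 1 := by
      have hb1 : 1 ≤ m ^ 3 := Nat.one_le_pow 3 m hm1
      zify at hc1 hb1 ⊢
      nlinarith [mul_nonneg (sub_nonneg.2 hc1) (sub_nonneg.2 hb1)]
    omega
  -- the row objects are symmetric under every permutation fixing the vertices `≥ k²`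
  refine hm ε hε ((Fin p ⊕ Fin q) ⊕ ((Edge m ⊕ Edge m) ⊕ Unit)) hcard U V
    (fun σ => if hσ : σ ∈ G then
      Sum.map (Sum.map (πp ⟨σ, hσ⟩) (πq ⟨σ, hσ⟩)) (Sum.map (Sum.map (SimpleGraph.Iso.completeGraph σ).mapEdgeSet (SimpleGraph.Iso.completeGraph σ).mapEdgeSet) id) else id)
    (fun σ hσfix l Q => ?_) hU hV ?_
  · have hσ : σ ∈ G := by
      rw [hG, mem_fixingSubgroup_iff]
      intro v hv
      exact hσfix v hv
    simp only [dif_pos hσ]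
    exact hsym ⟨σ, hσ⟩ l Q
  · intro Q u hQ hu
    rw [← hfact Q u hQ hu]
    rfl

/-- **No symmetric monotone LP gate computes `CLIQUE(m, ⌈m^δ⌉₊)` (every `δ ∈ (0,1/2)`, every `c`).** Eventually in `m`:
for all `p + q ≤ m^c`, all LP data `A, b, B ≥ 0` and all homomorphisms `πp : Sym(m) → Sym(p)`, `πq : Sym(m) → Sym(q)`
making the data invariant (`A_{πp σ i, πq σ j} = A_{ij}`, `b_{πp σ i} = b_i`, `B_{πp σ i, σ e} = B_{i,e}`), the
monotone LP-feasibility gate `x ↦ [∃ z ≥ 0, A z ≤ b + B x]` does not compute `CLIQUE(m, ⌈m^δ⌉₊)`. The symmetric case of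
the single-LP-gate (weak MLP gate) form of the crux, unconditionally (corollary of the local form: restrict `πp, πq`). [new] -/
theorem symmetric_lpGate_blind {δ : ℝ} (hδ0 : 0 < δ) (hδ : δ < 1 / 2) (c : ℕ) :
    ∀ᶠ m : ℕ in atTop, ∀ (p q : ℕ), p + q ≤ m ^ c →
      ∀ (A : Fin p → Fin q → ℝ) (b : Fin p → ℝ) (B : Fin p → Edge m → ℝ), (∀ i e, 0 ≤ B i e) →
      ∀ (πp : Equiv.Perm (Fin m) →* Equiv.Perm (Fin p)) (πq : Equiv.Perm (Fin m) →* Equiv.Perm (Fin q)),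
      (∀ σ i j, A (πp σ i) (πq σ j) = A i j) → (∀ σ i, b (πp σ i) = b i) →
      (∀ σ i e, B (πp σ i) ((SimpleGraph.Iso.completeGraph σ).mapEdgeSet e) = B i e) →
      ¬ ∀ x : Edge m → Bool, cliqueFn m ⌈(m : ℝ) ^ δ⌉₊ x = true ↔
          ∃ z : Fin q → ℝ, (∀ j, 0 ≤ z j) ∧ ∀ i, ∑ j, A i j * z j ≤ b i + ∑ e, B i e * (if x e then (1 : ℝ) else 0) := by
  filter_upwards [symmetric_lpGate_blind_local hδ0 hδ c] with m hm
  set G := fixingSubgroup (Equiv.Perm (Fin m)) {v : Fin m | ⌈(m : ℝ) ^ δ⌉₊ * ⌈(m : ℝ) ^ δ⌉₊ ≤ v.val} with hG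
  intro p q hpq A b B hB πp πq hA hb hBs
  exact hm p q hpq A b B hB (πp.comp G.subtype) (πq.comp G.subtype) (fun σ i j => hA σ i j) (fun σ i => hb σ i)
    (fun σ i e => hBs σ i e)

/-- **Registered helper stub (no symmetric LP gate computes CLIQUE).** Restatement of `symmetric_lpGate_blind` with all
parameters explicit. -/
theorem symmetric_gate : ∀ (δ : ℝ), 0 < δ → δ < 1 / 2 → ∀ c : ℕ, ∀ᶠ m : ℕ in Filter.atTop, ∀ (p q : ℕ), p + q ≤ m ^ c → ∀ (A : Fin p → Fin q → ℝ) (b : Fin p → ℝ) (B : Fin p → Edge m → ℝ), (∀ i e, 0 ≤ B i e) → ∀ (πp : Equiv.Perm (Fin m) →* Equiv.Perm (Fin p)) (πq : Equiv.Perm (Fin m) →* Equiv.Perm (Fin q)), (∀ σ i j, A (πp σ i) (πq σ j) = A i j) → (∀ σ i, b (πp σ i) = b i) → (∀ σ i e, B (πp σ i) ((SimpleGraph.Iso.completeGraph σ).mapEdgeSet e) = B i e) → ¬ ∀ x : Edge m → Bool, cliqueFn m ⌈(m : ℝ) ^ δ⌉₊ x = true ↔ ∃ z : Fin q → ℝ,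 (∀ j, 0 ≤ z j) ∧ ∀ i, ∑ j, A i j * z j ≤ b i + ∑ e, B i e * (if x e then (1 : ℝ) else 0) := by
  intro δ hδ0 hδ c
  exact symmetric_lpGate_blind hδ0 hδ c

/-- **Registered helper stub (no LP gate symmetric on `k²` vertices computes CLIQUE).** Restatement of
`symmetric_lpGate_blind_local` with all parameters explicit. -/
theorem symmetric_gate_local : ∀ (δ : ℝ), 0 < δ → δ < 1 / 2 → ∀ c : ℕ, ∀ᶠ m : ℕ in Filter.atTop, ∀ (p q : ℕ), p + q ≤ m ^ c → ∀ (A : Fin p → Fin q → ℝ) (b : Fin p → ℝ) (B : Fin p → Edge m → ℝ), (∀ i e, 0 ≤ B i e) → ∀ (πp : fixingSubgroup (Equiv.Perm (Fin m)) {v : Fin m | ⌈(m : ℝ) ^ δ⌉₊ * ⌈(m : ℝ) ^ δ⌉₊ ≤ v.val} →* Equiv.Perm (Fin p)) (πq : fixingSubgroup (Equiv.Perm (Fin m)) {v : Fin m | ⌈(m : ℝ) ^ δ⌉₊ * ⌈(m : ℝ) ^ δ⌉₊ ≤ v.val} →* Equiv.Perm (Fin q)), (∀ σ i j, A (πp σ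 i) (πq σ j) = A i j) → (∀ σ i, b (πp σ i) = b i) → (∀ σ i e, B (πp σ i) ((SimpleGraph.Iso.completeGraph (σ : Equiv.Perm (Fin m))).mapEdgeSet e) = B i e) → ¬ ∀ x : Edge m → Bool, cliqueFn m ⌈(m : ℝ) ^ δ⌉₊ x = true ↔ ∃ z : Fin q → ℝ, (∀ j, 0 ≤ z j) ∧ ∀ i, ∑ j, A i j * z j ≤ b i + ∑ e, B i e * (if x e then (1 : ℝ) else 0) := by
  intro δ hδ0 hδ c
  exact symmetric_lpGate_blind_local hδ0 hδ c

end

end Summit.PneNP.PneNP.Theorems
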